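import Summits.CriticalPhenomena.SAWScalingLimit.Theorems.SAWTotalPositivityCriticalBubbleBoundJoinUnfold
import Summits.CriticalPhenomena.SAWScalingLimit.Theorems.SAWTotalPositivityCriticalBubbleBoundJoinNonTouching
import Summits.CriticalPhenomena.SAWScalingLimit.Theorems.SAWTotalPositivityCriticalBubbleBoundJoinLedger
import Literature.Probability.RandomPlanarGeometry.SAWBridgeUpperBound
import Literature.Probability.RandomPlanarGeometry.SelfAvoidingWalkProofs

/-!
# Hammond's Proposition 4.5 in `x_c`-mass: global join plaquettes are exponentially few
(crux `SAWTotalPositivity.CriticalBubbleBound`, stmt-CriticalPhenomena-7117; line `docking-census-joining`,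
registered stub `gjoins_tail_bound` of the join-mass programme, lead prover c6)

`gjoins_tail_bound`: there are `A ≥ 0` and `ρ ∈ (0,1)` with
`#{χ ∈ lexRooted N : k ≤ #gjoins N χ} · x_c^{N+1} ≤ A ρ^k` for all `N, k`.
Counting: every such `χ` has a pairwise non-touching sub-family of its global join plaquettes of size
`k' ≥ ⌈k/9⌉` (`exists_nonTouching_subset`), hence at least `C(k', m)` non-touching `m`-subsets
(`m := ⌊k'/19⌋`); the pairs `(χ, κ)` inject into bridges of length `N + 2m + 6` (`gjoins_unfold`),
counted by `μ^{N+2m+6}` (`Zd.bridgeCount_le_pow`); with `C(k',m) ≥ 19^m ≥ (2μ²)^m` (`μ ≤ 3`) the mass is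
`≤ μ^5 2^{-m} ≤ 486 · 2^{-k/171}`. Small `N ≤ 2` carry no more than three global join plaquettes.
[cite: Hammond2015SAPJoining, Proposition 4.5]
-/

noncomputable section

open Literature.Probability.LatticeModels
open Literature.Probability.RandomPlanarGeometry Literature.Probability.RandomPlanarGeometry.SAW
open scoped BigOperators
open Summit.CriticalPhenomena.SAWScalingLimit.Theorems.CriticalBubbleBound.Negative (e₀)
open Summit.CriticalPhenomena.SAWScalingLimit.Theorems.CriticalBubbleBound.Docking

namespace Summit.CriticalPhenomena.SAWScalingLimit.Theorems.CriticalBubbleBound.Join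

/-! ## A lower bound for binomial coefficients: `n^m ≤ m^m · C(n, m)` -/

/-- For `m ≤ n`: `n^m ≤ m^m · C(n,m)` (i.e. `C(n,m) ≥ (n/m)^m`). [folklore] -/
theorem pow_le_pow_mul_choose {n m : ℕ} (hmn : m ≤ n) : n ^ m ≤ m ^ m * Nat.choose n m := by
  -- factorwise: `n * (m - i) ≤ m * (n - i)` for `i < m`
  have key : n ^ m * m.factorial ≤ m ^ m * n.descFactorial m := by
    rw [← Nat.descFactorial_self m, Nat.descFactorial_eq_prod_range m m,
      Nat.descFactorial_eq_prod_range n m, Finset.pow_eq_prod_const n m, Finset.pow_eq_prod_const m m,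
      ← Finset.prod_mul_distrib, ← Finset.prod_mul_distrib]
    refine Finset.prod_le_prod (fun i _ => Nat.zero_le _) fun i hi => ?_
    rw [Finset.mem_range] at hi
    have h1 : i ≤ m := hi.le
    have h2 : i ≤ n := le_trans h1 hmn
    zify [h1, h2]
    nlinarith
  rw [Nat.descFactorial_eq_factorial_mul_choose] at key
  have hf : 0 < m.factorial := Nat.factorial_pos m
  have : n ^ m * m.factorial ≤ (m ^ m * n.choose m) * m.factorial := by
    calc n ^ m * m.factorial ≤ m ^ m * (m.factorial * n.choose m) := key
      _ = (m ^ m * n.choose m) * m.factorial := by ring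
  exact Nat.le_of_mul_le_mul_right this hf

/-- If `19 m ≤ n` then `19^m ≤ C(n, m)`. [folklore] -/
theorem nineteen_pow_le_choose {n m : ℕ} (h : 19 * m ≤ n) : 19 ^ m ≤ Nat.choose n m := by
  rcases Nat.eq_zero_or_pos m with rfl | hm
  · simp
  have hmn : m ≤ n := le_trans (Nat.le_mul_of_pos_left m (by norm_num)) h
  have h1 := pow_le_pow_mul_choose hmn
  have h2 : (19 * m) ^ m ≤ n ^ m := Nat.pow_le_pow_left h m
  rw [mul_pow] at h2
  have h3 : 19 ^ m * m ^ m ≤ m ^ m * n.choose m := le_trans h2 h1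
  rw [mul_comm] at h3
  exact Nat.le_of_mul_le_mul_left h3 (pow_pos hm m)

/-! ## Elementary facts on global join plaquettes of small classes -/

/-- A class has at most `N + 1` global join plaquettes (their corners are vertices). [folklore] -/
theorem card_gjoins_le_succ (N : ℕ) (χ : ℕ → Site 2) : (gjoins N χ).card ≤ N + 1 := by
  classical
  calc (gjoins N χ).card ≤ (verts N χ).card := Finset.card_le_card (Finset.filter_subset _ _)
    _ ≤ (Finset.range (N + 1)).card := Finset.card_image_le
    _ = N + 1 := Finset.card_range _

/-! ## The registered stub -/

open Classical in
/-- **Hammond's Proposition 4.5 in `x_c`-mass** (registered stub `gjoins_tail_bound`): the class mass of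
lex-rooted polygons carrying at least `k` global join plaquettes decays exponentially in `k`, uniformly
in the length. [cite: Hammond2015SAPJoining, Proposition 4.5] -/
theorem gjoins_tail_bound : ∃ A ρ : ℝ, 0 ≤ A ∧ 0 < ρ ∧ ρ < 1 ∧ ∀ N k : ℕ,
    (((lexRooted N).filter fun χ => k ≤ (gjoins N χ).card).card : ℝ) * criticalFugacity ^ (N + 1) ≤
      A * ρ ^ k := by
  -- constants
  set ρ : ℝ := (1 / 2 : ℝ) ^ (1 / 171 : ℝ) with hρ
  have hρ0 : 0 < ρ := Real.rpow_pos_of_pos (by norm_num) _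
  have hρ1 : ρ < 1 := Real.rpow_lt_one (by norm_num) (by norm_num) (by norm_num)
  have hρle1 : ρ ≤ 1 := hρ1.le
  obtain ⟨K, hK⟩ := jterm_le_exp
  set C₀ : ℝ := Real.exp (|K| * Real.sqrt 19) with hC₀
  have hC₀0 : 0 ≤ C₀ := (Real.exp_pos _).le
  have hx := criticalFugacity_pos_lt_one'
  have hx0 : 0 ≤ criticalFugacity := hx.1.le
  set μ : ℝ := connectiveConstant
  have hμx : criticalFugacity = μ⁻¹ := rfl
  have hμ0 : 0 < μ := by
    have : μ = criticalFugacity⁻¹ := by rw [hμx, inv_inv]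
    rw [this]; exact inv_pos.2 hx.1
  have hμ3 : μ ≤ 3 := connectiveConstant_le_three
  refine ⟨486 + C₀ / ρ ^ 3, ρ, by positivity, hρ0, hρ1, fun N k => ?_⟩
  set S := (lexRooted N).filter fun χ => k ≤ (gjoins N χ).card with hS
  have hS_sub : S ⊆ lexRooted N := Finset.filter_subset _ _
  -- the class mass of all of `lexRooted N` is `cterm N ≤ C₀` for `N ≤ 2`, and `#S ≤ #lexRooted N`
  have hmassS : (S.card : ℝ) * criticalFugacity ^ (N + 1) ≤ cterm N := by
    rw [cterm]
    exact mul_le_mul_of_nonneg_right (by exact_mod_cast Finset.card_le_card hS_sub) (pow_nonneg hx0 _)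
  have hρk_ge : ∀ {k : ℕ} {t : ℝ}, (k : ℝ) / 171 ≤ t → (1 / 2 : ℝ) ^ t ≤ ρ ^ k := by
    intro k t hkt
    have : ρ ^ k = (1 / 2 : ℝ) ^ ((k : ℝ) / 171) := by
      rw [hρ, ← Real.rpow_natCast, ← Real.rpow_mul (by norm_num)]
      congr 1; ring
    rw [this]
    exact Real.rpow_le_rpow_of_exponent_ge (by norm_num) (by norm_num) hkt
  rcases lt_or_ge N 3 with hN | hN
  · -- small `N`
    rcases le_or_gt k 3 with hk | hk
    · -- `k ≤ 3`: mass ≤ cterm N ≤ C₀ ≤ (C₀/ρ^3) ρ^k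
      have hcterm : cterm N ≤ C₀ := by
        have h1 : cterm N = jterm (N + joinShift) := by
          rw [jterm_of_le (Nat.le_add_left _ _), Nat.add_sub_cancel]
        rw [h1]
        refine le_trans (hK _) ?_
        rw [hC₀]
        apply Real.exp_le_exp.2
        have hs : Real.sqrt ((N + joinShift : ℕ) : ℝ) ≤ Real.sqrt 19 := by
          apply Real.sqrt_le_sqrt
          have : N + joinShift ≤ 19 := by simp only [joinShift]; omega
          exact_mod_cast this
        calc K * Real.sqrt ((N + joinShift : ℕ) : ℝ) ≤ |K| * Real.sqrt ((N + joinShift : ℕ) : ℝ) :=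
              mul_le_mul_of_nonneg_right (le_abs_self K) (Real.sqrt_nonneg _)
          _ ≤ |K| * Real.sqrt 19 := mul_le_mul_of_nonneg_left hs (abs_nonneg K)
      have hρk : ρ ^ 3 ≤ ρ ^ k := pow_le_pow_of_le_one hρ0.le hρle1 hk
      have hρ3 : 0 < ρ ^ 3 := pow_pos hρ0 3
      calc (S.card : ℝ) * criticalFugacity ^ (N + 1) ≤ C₀ := le_trans hmassS hcterm
        _ = C₀ / ρ ^ 3 * ρ ^ 3 := by field_simp
        _ ≤ C₀ / ρ ^ 3 * ρ ^ k := mul_le_mul_of_nonneg_left hρk (div_nonneg hC₀0 hρ3.le)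
        _ ≤ (486 + C₀ / ρ ^ 3) * ρ ^ k := by
            apply mul_le_mul_of_nonneg_right _ (pow_nonneg hρ0.le _); linarith
    · -- `k ≥ 4`: no class of walk length `≤ 2` has four global join plaquettes
      have hSe : S = ∅ := by
        rw [Finset.eq_empty_iff_forall_notMem]
        intro χ hχ
        rw [hS, Finset.mem_filter] at hχ
        have := card_gjoins_le_succ N χ
        omega
      rw [hSe, Finset.card_empty, Nat.cast_zero, zero_mul]
      positivity
  · -- `N ≥ 3`: the multi-valued map
    set k' := (k + 8) / 9 with hk'
    set m := k' / 19 with hm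
    have hk'9 : k ≤ 9 * k' := by omega
    have hm19 : 19 * m ≤ k' := by omega
    have hkm : (k : ℝ) / 171 ≤ (m : ℝ) + 1 := by
      have : k ≤ 171 * m + 170 := by omega
      have h' : (k : ℝ) ≤ 171 * (m : ℝ) + 170 := by exact_mod_cast this
      rw [div_le_iff₀ (by norm_num : (0 : ℝ) < 171)]
      linarith
    -- non-touching sub-families
    have hT : ∀ χ : ℕ → Site 2, ∃ T ⊆ gjoins N χ,
        (∀ q ∈ T, ∀ q' ∈ T, q ≠ q' → 2 ≤ |q 0 - q' 0| ∨ 2 ≤ |q 1 - q' 1|) ∧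
          (gjoins N χ).card ≤ 9 * T.card := fun χ => exists_nonTouching_subset (gjoins N χ)
    choose T hTsub hTnt hTcard using hT
    -- the pair finset
    set P : Finset (Σ _ : ℕ → Site 2, Finset (Site 2)) := S.sigma fun χ => (T χ).powersetCard m with hP
    have hPcard : S.card * Nat.choose k' m ≤ P.card := by
      rw [hP, Finset.card_sigma, ← smul_eq_mul, ← Finset.sum_const]
      refine Finset.sum_le_sum fun χ hχ => ?_
      rw [Finset.card_powersetCard]
      apply Nat.choose_le_choose
      rw [hS, Finset.mem_filter] at hχ
      have := hTcard χ
      omega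
    -- the injection into bridges
    obtain ⟨Φ, hΦmem, hΦinj⟩ := gjoins_unfold N m hN
    have hmaps : Set.MapsTo (fun p : (Σ _ : ℕ → Site 2, Finset (Site 2)) => Φ p.1 p.2) ↑P
        ↑(Zd.bridges 2 (N + 2 * m + 6)) := by
      rintro ⟨χ, κ⟩ hp
      rw [Finset.mem_coe, hP, Finset.mem_sigma, Finset.mem_powersetCard] at hp
      obtain ⟨hχ, hκ, hκm⟩ := hp
      exact hΦmem χ (hS_sub hχ) κ (hκ.trans (hTsub χ))
        (fun q hq q' hq' hne => hTnt χ q (hκ hq) q' (hκ hq') hne) hκm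
    have hinj : Set.InjOn (fun p : (Σ _ : ℕ → Site 2, Finset (Site 2)) => Φ p.1 p.2) ↑P := by
      rintro ⟨χ, κ⟩ hp ⟨χ', κ'⟩ hp' heq
      rw [Finset.mem_coe, hP, Finset.mem_sigma, Finset.mem_powersetCard] at hp hp'
      obtain ⟨hχ, hκ, hκm⟩ := hp
      obtain ⟨hχ', hκ', hκm'⟩ := hp'
      obtain ⟨h1, h2⟩ := hΦinj χ (hS_sub hχ) χ' (hS_sub hχ') κ (hκ.trans (hTsub χ)) κ' (hκ'.trans (hTsub χ'))
        (fun q hq q' hq' hne => hTnt χ q (hκ hq) q' (hκ hq') hne)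
        (fun q hq q' hq' hne => hTnt χ' q (hκ' hq) q' (hκ' hq') hne) hκm hκm' heq
      subst h1; subst h2; rfl
    have hPle : P.card ≤ (Zd.bridges 2 (N + 2 * m + 6)).card := Finset.card_le_card_of_injOn _ hmaps hinj
    -- in `ℝ`: `#S · C(k',m) ≤ μ^(N+2m+6)`
    have hbr : ((Zd.bridges 2 (N + 2 * m + 6)).card : ℝ) ≤ μ ^ (N + 2 * m + 6) := by
      have := Zd.bridgeCount_le_pow (d := 2) (N + 2 * m + 6)
      rw [Zd.connectiveConstant_two] at this
      exact this
    have hchoose : (19 : ℝ) ^ m ≤ (Nat.choose k' m : ℝ) := by exact_mod_cast nineteen_pow_le_choose hm19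
    have hmain : (S.card : ℝ) * (19 : ℝ) ^ m ≤ μ ^ (N + 2 * m + 6) := by
      calc (S.card : ℝ) * (19 : ℝ) ^ m ≤ (S.card : ℝ) * (Nat.choose k' m : ℝ) :=
            mul_le_mul_of_nonneg_left hchoose (Nat.cast_nonneg _)
        _ ≤ (P.card : ℝ) := by exact_mod_cast hPcard
        _ ≤ ((Zd.bridges 2 (N + 2 * m + 6)).card : ℝ) := by exact_mod_cast hPle
        _ ≤ μ ^ (N + 2 * m + 6) := hbr
    -- `μ^(2m) ≤ 9^m`, `x^(N+1) = μ^-(N+1)`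
    have h19 : (0 : ℝ) < 19 ^ m := pow_pos (by norm_num) m
    have hμpow : μ ^ (N + 2 * m + 6) = μ ^ (N + 1) * (μ ^ 2) ^ m * μ ^ 5 := by
      rw [← pow_mul, ← pow_add, ← pow_add]; congr 1; ring
    have hμ2 : μ ^ 2 ≤ 9 := by nlinarith
    have hμ5 : μ ^ 5 ≤ 243 := by
      calc μ ^ 5 ≤ (3 : ℝ) ^ 5 := pow_le_pow_left₀ hμ0.le hμ3 5
        _ = 243 := by norm_num
    have hxpow : criticalFugacity ^ (N + 1) * μ ^ (N + 1) = 1 := by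
      rw [hμx, ← mul_pow, inv_mul_cancel₀ hμ0.ne', one_pow]
    have e1 : (S.card : ℝ) * criticalFugacity ^ (N + 1) * (19 : ℝ) ^ m ≤ (μ ^ 2) ^ m * μ ^ 5 := by
      have h := mul_le_mul_of_nonneg_right hmain (pow_nonneg hx0 (N + 1))
      rw [hμpow] at h
      calc (S.card : ℝ) * criticalFugacity ^ (N + 1) * (19 : ℝ) ^ m
          = (S.card : ℝ) * (19 : ℝ) ^ m * criticalFugacity ^ (N + 1) := by ring
        _ ≤ μ ^ (N + 1) * (μ ^ 2) ^ m * μ ^ 5 * criticalFugacity ^ (N + 1) := h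
        _ = (μ ^ 2) ^ m * μ ^ 5 * (criticalFugacity ^ (N + 1) * μ ^ (N + 1)) := by ring
        _ = (μ ^ 2) ^ m * μ ^ 5 := by rw [hxpow, mul_one]
    have e2 : (S.card : ℝ) * criticalFugacity ^ (N + 1) ≤ (μ ^ 2) ^ m * μ ^ 5 / (19 : ℝ) ^ m := by
      rw [le_div_iff₀ h19]; exact e1
    have hq : μ ^ 2 / 19 ≤ 1 / 2 := by
      rw [div_le_iff₀ (by norm_num : (0 : ℝ) < 19)]; linarith
    have e3 : (μ ^ 2) ^ m * μ ^ 5 / (19 : ℝ) ^ m ≤ 243 * (1 / 2 : ℝ) ^ m := by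
      calc (μ ^ 2) ^ m * μ ^ 5 / (19 : ℝ) ^ m = (μ ^ 2 / 19) ^ m * μ ^ 5 := by rw [div_pow]; ring
        _ ≤ (1 / 2 : ℝ) ^ m * 243 :=
            mul_le_mul (pow_le_pow_left₀ (by positivity) hq m) hμ5 (by positivity) (by positivity)
        _ = 243 * (1 / 2 : ℝ) ^ m := by ring
    have e4 : (1 / 2 : ℝ) ^ m ≤ 2 * ρ ^ k := by
      have h := hρk_ge (k := k) (t := (m : ℝ) + 1) hkm
      have h' : (1 / 2 : ℝ) ^ ((m : ℝ) + 1) = (1 / 2 : ℝ) ^ m * (1 / 2) := by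
        rw [Real.rpow_add (by norm_num), Real.rpow_natCast, Real.rpow_one]
      rw [h'] at h
      linarith
    have hρ3 : 0 ≤ C₀ / ρ ^ 3 := div_nonneg hC₀0 (pow_nonneg hρ0.le 3)
    calc (S.card : ℝ) * criticalFugacity ^ (N + 1) ≤ 243 * (1 / 2 : ℝ) ^ m := le_trans e2 e3
      _ ≤ 243 * (2 * ρ ^ k) := mul_le_mul_of_nonneg_left e4 (by norm_num)
      _ = 486 * ρ ^ k := by ring
      _ ≤ (486 + C₀ / ρ ^ 3) * ρ ^ k := by
          apply mul_le_mul_of_nonneg_right _ (pow_nonneg hρ0.le _); linarith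

end Summit.CriticalPhenomena.SAWScalingLimit.Theorems.CriticalBubbleBound.Join

end
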